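import Summits.QuantumFields.YangMills.Theorems.BalabanUVNodesN07Delta2OfRecordTraceSectors
import HarnessLib

/-!
# NODE N07 — THE SECT. C ROWS `hCreal`, `hCtr` OF THE `N = 2` REDUCTION «`RegimeTok ⟹ SchemeTokOfRecord`» TRADED FOR ONE SCALAR SMALLNESS `ε_C + a_C < r(U₀)`: at a guarded background
# there is a radius `r > 0` (from ✓`CslOfRecord_conj_eventually_nhds` and ✓`trace_CslOfRecord_eventually_nhds'`) below which `C^{𝔰𝔩}` maps Hermitian jets to Hermitian TRACELESS block
# fields; so whenever Sect. C's radii satisfy `ε_C + a_C < r`, the rows hold and ✓`schemeTokOfRecord_two_of_regimeTok'` applies ([15] (44) p. 285, (51) p. 286, Prop. 6 p. 295; [B9] (3.134))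

Cell `pub-ymgap`, width seat `pub-ymgap-dag-n07-w3` (g27), CLAIM-8.  `--kind proof --supports stmt-QuantumFields-27238 --as helper`; count-neutral.
[15] = [Balaban1985Variational]; [B9] = [Balaban1985BackgroundPropagators].

CONTENTS.
* §1 ★`exists_radius_cslRows` — `∃ r > 0`, for every `A′` with `‖A′‖ < r` and Hermitian presented field: `C^{𝔰𝔩}(A′)` is conjugation-fixed AND traceless-valued (any `N`; guard).
* §2 ★★★`schemeTokOfRecord_two_of_regimeTok_of_small` — `N = 2`: `∃ r > 0` (depending on the background, the level data and `levB` only) such that for ALL scheme data with Sect. C radii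
  `ε_C + a_C < r`: guard + `G′` real ∧ `S`-commuting + `Delta2Tok ∧ Delta2SymmTok` + Sect. C `Regime H♭ 0 C^{𝔰𝔩} …` (`a₃ ≤ a_C`) + `Prop4Hyp` + domain (20)-smallness + `RegimeTok`
  ⟹ `SchemeTokOfRecord`.

HONEST LABELS.  The radius `r` is NOT quantified in Bałaban's constants (that would be an estimate); `RegimeTok`, Sect. C's regime and `Prop4Hyp` stay DISPLAYED.  Count-neutral; N07 NOT discharged;
P0 ⟨26900⟩ OPEN; R4 is the conditional finite-𝕋⁴ rung only.  Nothing here is a claim about the Yang–Mills mass gap (`Summit.QuantumFields`): finite torus, fixed `ε`; nothing continuum ∕ OS ∕ Clay.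
-/

set_option autoImplicit false

noncomputable section

open scoped Matrix Matrix.Norms.L2Operator InnerProductSpace ComplexConjugate BigOperators Topology

namespace Summit.QuantumFields.YangMills.Theorems.N07SchemeTokOfRecordTwoSmall

open Filter Metric
open Literature.MathematicalPhysics.QuantumFieldTheory.Balaban1983to89
open Literature.MathematicalPhysics.QuantumFieldTheory.Balaban1983to89.T4Continuum (T4Family)
open T4Continuum BlockAveraging
open B9SectCLatticeCarrier (Bond)
open B9Eq311L2Pairing (WL2)
open B9Eq311TracePairing (starW)
open B11Eq103H1Complex (SiteL2K BondL2K)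
open B11Eq111FrakG (nabla115)
open B11Eq115Space (NegSize NegSup levWeight JetSup)
open B11Eq174Chart (Regime)
open B11Prop6Scheme (Prop4Hyp)
open Node00
open Summit.QuantumFields.YangMills.Theorems.N07TraceSectorDefs (scalPartW)
open Summit.QuantumFields.YangMills.Theorems.N07COfRecordRealSliceNhds (CslOfRecord_conj_eventually_nhds)
open Summit.QuantumFields.YangMills.Theorems.N07CslOfRecordTraceSectors (trace_CslOfRecord_eventually_nhds')
open Summit.QuantumFields.YangMills.Theorems.N07LieTokAtOfRecordTwo (conjJet_eq_self_iff)
open Summit.QuantumFields.YangMills.Theorems.N07Delta2OfRecordTraceSectors (schemeTokOfRecord_two_of_regimeTok')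

/-! ## §1  A radius for the Sect. C rows -/

section Radius

variable (F : T4Family) (N : ℕ) [NeZero N] (K : ℕ) (k : ℕ) (Ω : ℕ → Set (Site (F.P K) 0)) (U₀ : GaugeField (F.P K) 0 (SU N))
  [Fact (0 < (F.L : ℝ))] [Fact (0 < (F.P K).eta k)] (levB : PBond (F.P K) k → ℕ)

/-- ★ **A RADIUS BELOW WHICH `C^{𝔰𝔩}` MAPS HERMITIAN JETS TO HERMITIAN TRACELESS BLOCK FIELDS** (guard; `r` depends on the background and the level data only; not quantified).
[cite: Balaban1985Variational, (44) p.285, (20) p.281, (51) p.286; Balaban1985Averaging, (21)–(23) p.21] -/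
theorem exists_radius_cslRows (hU₀ : SmallBelow (avOfRecord F N K) k U₀) :
    ∃ r > 0, ∀ A : Space115Lit F N K k Ω U₀, ‖A‖ < r →
      ((JetSup.equiv _ _ (nabla115 ((F.P K).eta k) (unitsOfRecord F N U₀))).symm
          (star (JetSup.equiv _ _ (nabla115 ((F.P K).eta k) (unitsOfRecord F N U₀)) A)) : Space115Lit F N K k Ω U₀) = A →
      ((NegSup.equiv _ _).symm (star (NegSup.equiv _ _ (CslOfRecord F N K k Ω U₀ levB A))) : NegSize (F.L : ℝ) ((F.P K).eta k) levB 0 (Matrix (Fin N) (Fin N) ℂ)) =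
          CslOfRecord F N K k Ω U₀ levB A ∧
        ∀ c, (NegSup.equiv _ _ (CslOfRecord F N K k Ω U₀ levB A) c).trace = 0 := by
  obtain ⟨r₁, hr₁, h₁⟩ := Metric.eventually_nhds_iff.1 (CslOfRecord_conj_eventually_nhds F N K k Ω U₀ levB hU₀)
  obtain ⟨r₂, hr₂, h₂⟩ := Metric.eventually_nhds_iff.1 (trace_CslOfRecord_eventually_nhds' F N K k Ω U₀ levB hU₀)
  refine ⟨min r₁ r₂, lt_min hr₁ hr₂, fun A hA hAh => ⟨?_, ?_⟩⟩
  · have hd : dist A 0 < r₁ := by rw [dist_zero_right]; exact hA.trans_le (min_le_left _ _)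
    refine h₁ hd fun b => ?_
    rw [evLit_apply]
    exact (conjJet_eq_self_iff F N K k Ω U₀ A).1 hAh _
  · have hd : dist A 0 < r₂ := by rw [dist_zero_right]; exact hA.trans_le (min_le_right _ _)
    exact h₂ hd hAh

end Radius

/-! ## §2  The `N = 2` reduction with the Sect. C rows traded for `ε_C + a_C < r` -/

section Two

variable (F : T4Family) (K : ℕ) (k : ℕ) (Ω : ℕ → Set (Site (F.P K) 0)) (U₀ : GaugeField (F.P K) 0 (SU 2))
  [Fact (0 < (F.L : ℝ))] [Fact (0 < (F.P K).eta k)] [Fact (0 < c0Rec F K k)] [Fact (∀ c, 0 < wBRec F K k c)] (levB : PBond (F.P K) k → ℕ)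

set_option maxHeartbeats 1600000 in
/-- ★★★ **`RegimeTok ⟹ SchemeTokOfRecord` AT `N = 2` WITH SECT. C's RADII SMALL**: at a guarded background there is `r > 0` such that for every scheme datum (`dom`, `G′` real and
`S`-commuting, the (3.134) `Δ2`, the Landau `a`, the displayed positivity proofs, the constants) and Sect. C letters with `Regime H♭ 0 C^{𝔰𝔩} b 0 C₂ c₄ 0 a_C ε_C`, `Prop4Hyp`, `a₃ ≤ a_C` and
`ε_C + a_C < r`, the domain (20)-smallness and Prop. 6's `RegimeTok` give def-Y's bundle `SchemeTokOfRecord`. [cite: Balaban1985Variational, Prop. 6 (115)–(121) p.295, (44) p.285; Balaban1985BackgroundPropagators, (3.134) p.422] -/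
theorem schemeTokOfRecord_two_of_regimeTok_of_small (h : SmallBelow (avOfRecord F 2 K) k U₀) :
    ∃ r > 0, ∀ (dom : Set (GaugeField (F.P K) k (SU 2)))
      (Gp : SiteL2K ℂ (F.P K).d (fun _ => (F.P K).sitesPerDir 0) (c0Rec F K k) (WRec 2) →ₗ[ℂ]
        SiteL2K ℂ (F.P K).d (fun _ => (F.P K).sitesPerDir 0) (c0Rec F K k) (WRec 2))
      (Δ2 : BondL2K ℂ (F.P K).d (fun _ => (F.P K).sitesPerDir 0) (c0Rec F K k) (WRec 2) →ₗ[ℂ]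
        BondL2K ℂ (F.P K).d (fun _ => (F.P K).sitesPerDir 0) (c0Rec F K k) (WRec 2)) (a : ℝ)
      (hposπ : ∀ x, x ≠ 0 → 0 < RCLike.re ⟪x, laplaceAOfRecordAt F 2 k U₀ (hessOpOfRecord128 F 2 k U₀ Gp (QflatOfRecord F 2 k) Δ2)
        (QOfRecord F 2 k U₀) (QflatOfRecord F 2 k) a x⟫_ℂ)
      (hposb : ∀ x, x ≠ 0 → 0 < RCLike.re ⟪x, laplaceAOfRecord F 2 k U₀ (QOfRecord F 2 k U₀) (QflatOfRecord F 2 k) a x⟫_ℂ)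
      (hQ : Function.Surjective (QOfRecord F 2 k U₀)) (εC B₀ C₄ a₃ j a𝔄 ε₄ b C₂ c₄ aC : ℝ),
      Regime (H1OfRecordAtBgFlat F 2 K k Ω U₀ levB a hposb hQ) 0 (CslOfRecord F 2 K k Ω U₀ levB) b 0 C₂ c₄ 0 aC εC →
      Prop4Hyp (CslOfRecord F 2 K k Ω U₀ levB) C₂ c₄ → a₃ ≤ aC → εC + aC < r →
      (∀ s, Gp (starW (phiRec 2) s) = starW (phiRec 2) (Gp s)) → (∀ s, Gp (scalPartW 2 _ s) = scalPartW 2 _ (Gp s)) →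
      Delta2Tok F 2 K k Ω U₀ levB a hposb hQ Δ2 → Delta2SymmTok F 2 K k Ω U₀ Δ2 →
      (∀ V ∈ dom, ∀ c, ‖(V c : Matrix (Fin 2) (Fin 2) ℂ) * star (Averaging.iter (avOfRecord F 2 K) k U₀ c : Matrix (Fin 2) (Fin 2) ℂ) - 1‖ ≤ 1 / 4) →
      (bgSchemeOfRecord F 2 K k Ω U₀ dom levB Gp Δ2 a hposπ hposb hQ εC B₀ C₄ a₃ j a𝔄 ε₄).RegimeTok →
      SchemeTokOfRecord F 2 K k Ω U₀ dom levB Gp Δ2 a hposπ hposb hQ εC B₀ C₄ a₃ j a𝔄 ε₄ := by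
  obtain ⟨r, hr, hrows⟩ := exists_radius_cslRows F 2 K k Ω U₀ levB h
  refine ⟨r, hr, fun dom Gp Δ2 a hposπ hposb hQ εC B₀ C₄ a₃ j a𝔄 ε₄ b C₂ c₄ aC RC hP haC hsmall hGpR hGpS hΔ hs hdom hR => ?_⟩
  have hCreal : ∀ A : Space115Lit F 2 K k Ω U₀,
      ((JetSup.equiv _ _ (nabla115 ((F.P K).eta k) (unitsOfRecord F 2 U₀))).symm
          (star (JetSup.equiv _ _ (nabla115 ((F.P K).eta k) (unitsOfRecord F 2 U₀)) A)) : Space115Lit F 2 K k Ω U₀) = A →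
      ‖A‖ ≤ εC + aC → ((NegSup.equiv _ _).symm (star (NegSup.equiv _ _ (CslOfRecord F 2 K k Ω U₀ levB A))) :
        NegSize (F.L : ℝ) ((F.P K).eta k) levB 0 (Matrix (Fin 2) (Fin 2) ℂ)) = CslOfRecord F 2 K k Ω U₀ levB A :=
    fun A hA hn => (hrows A (hn.trans_lt hsmall) hA).1
  have hCtr : ∀ A : Space115Lit F 2 K k Ω U₀,
      ((JetSup.equiv _ _ (nabla115 ((F.P K).eta k) (unitsOfRecord F 2 U₀))).symm
          (star (JetSup.equiv _ _ (nabla115 ((F.P K).eta k) (unitsOfRecord F 2 U₀)) A)) : Space115Lit F 2 K k Ω U₀) = A →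
      (∀ b', (JetSup.equiv _ _ (nabla115 ((F.P K).eta k) (unitsOfRecord F 2 U₀)) A b').trace = 0) →
      ‖A‖ ≤ εC + aC → ∀ c, (NegSup.equiv _ _ (CslOfRecord F 2 K k Ω U₀ levB A) c).trace = 0 :=
    fun A hA _ hn => (hrows A (hn.trans_lt hsmall) hA).2
  exact schemeTokOfRecord_two_of_regimeTok' F K k Ω U₀ dom levB a hposπ hposb hQ εC B₀ C₄ a₃ j a𝔄 ε₄ RC hCreal hCtr h hGpR hGpS hΔ hs hP haC hR hdom

end Two

end Summit.QuantumFields.YangMills.Theorems.N07SchemeTokOfRecordTwoSmall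

end
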